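import Summits.QuantumAdvantage.QuantumAdvantage.Theses.CubicForrelation
import Literature.Computability.QuantumComplexity.SignedCubicForrelation
import Literature.Computability.QuantumComplexity.ForrelationMSubspaceDuality
import Literature.Computability.QuantumComplexity.CubicForrelationEstimatorAnalysis
import Literature.Computability.Complexity.PromiseBPPFromFPDecider
import Summits.QuantumAdvantage.QuantumAdvantage.Theorems.CubicForrelationInPrBPP.Negative.FlatSign
import Summits.QuantumAdvantage.QuantumAdvantage.Theorems.SignedCubicForrelationInPrBPP.Negative.GoldCube
import Summits.QuantumAdvantage.QuantumAdvantage.Theorems.SignedCubicForrelationInPrBPP.Negative.CrossCorrelation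

/-!
# Skeleton line `seed-to-sign` for crux `SignedCubicForrelationInPrBPP` (stmt-QuantumAdvantage-13933)

Route `QuantumAdvantage/CubicForrelation`, crux r7 (rank 7, the route's `¬X`):
`S := SignedCubicForrelationInPrBPP` = `signedCubicForrelationProblem 2 ∈ PromiseBPP'` (`rfl`,
`Disproof.crux_eq`): SIGNED cubic 2-fold Forrelation — `B₂`-circuits computing `a, b` of 𝔽₂-degree `≤ 3`,
`n` even; YES `Φ ≥ 3/5`, NO `Φ ≤ -3/5` — is in textbook promise-`BPP`. Planner skeleton, crux-plan round 1
(planner-cruxplan-stmt-QuantumAdvantage-13933-seed-to-sign-0, 2026-08-16); idea card `Ideas/seed-to-sign.md`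
(ideator 1); triage r1: 3 × pass (merge notes: `≈ polar-radical-seeds` as ONE line seed → closure → sign;
the `t = 0` sign readout is LANDED; every "⇒ crux" transfer must route through `NearExactIsExact` + the
band programme). Line card: `Lines/seed-to-sign.md`.

## The line: one vector of the hidden Lagrangian decides the sign; the rest is isolation + the band

On an EXACT pair (`Φ = ±1`: `b` bent with dual `a` or `¬a`) the whole quantum resource at `k = 2` is ONE
bit, the sign, and it is carried by the hidden Lagrangian `E^⊥ ⊕ E` of any M-subspace `E` of `b`
(duality, LANDED: `DerivativeWalsh.dual_affine_on_perp_cosets`). The card's two levers are PROVED in this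
file, so what remains of the exact slice is a SEARCH problem plus machine plumbing:

* `pingPong` (PROVED, the card's lemma "PingPong"): for `ξ ∈ E^⊥` the derivative `x ↦ a(x) ⊕ a(x ⊕ ξ)`
  is constant on the cosets of `E^⊥`, so the row `u ↦ T_a(ξ,u)` of the landed derivative Walsh table
  (`DerivativeWalsh.dwt`) vanishes OFF `E`: a seed vector of `E^⊥` hands over an affine subspace of `E`
  (the Walsh support of the quadratic `D_ξ a`, exact by Dickson), and symmetrically — the alternating
  closure ("ping-pong") is SOUND: it never leaves the Lagrangian.
* `isMSubspace_perp_of_exact` / `pingPong_symm` (PROVED): duality in M-subspace form (`E^⊥` is an M-subspace of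
  `a`), hence the closure runs in BOTH directions (rows of `T_b` at `e ∈ E` live inside `E^⊥`).
* `partialSign` / `partialSign_affine` (PROVED, the card's lemma "PartialSign", all `t`): for `Φ² = 1`,
  ANY `⊕`-closed `F` and any `v, w`,
  `|F| · ∑_{y ∈ w ⊕ F^⊥} (-1)^{a(y) + v·y} = √(2ⁿ) · Φ · ∑_{x ∈ F} (-1)^{x·w} (-1)^{b(v ⊕ x)}`;
  if `b` is affine on the coset `v ⊕ F` with linear part `w` the right sum is `|F| (-1)^{b(v)}`, so the
  `2ⁿ/|F|` signs `(-1)^{a(y)+v·y}` on the dual coset have mean EXACTLY `Φ (-1)^{b(v)} |F| 2^{-n/2}`: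
  relative bias `2^{-t}` for `|F| = 2^{n/2-t}` — with `t ≤ c·log₂(n+1)` the sign of `Φ` is read by
  sampling `poly(n)` points of one coset (the `t = 0` case is the landed `FlatSign.forrelation_mul_cosetBias_eq`
  / `sign_rule_of_forrelation_eq_one`).
* `exists_linearPart` / `readout_of_affineFlat` (PROVED): from the shape a finder's output is VERIFIED in
  (`IsAffineOnCoset b v F`, `F` a subspace) some `w` — the linear part, Gaussian elimination — satisfies the
  hypothesis of `partialSign_affine` (every `±1` character of a subspace is `x ↦ (-1)^{x·w}`,
  `exists_twist_eq_char`, by a second-moment count), so ALL the mathematics of the readout is closed here: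
  `stub_exactReadout` is sampling + machine plumbing only.
* `W_eq_sum_matched` / `fsum_eq_sum_matched` (PROVED; triage r1-3 gen-2 "dual-value sampler"): from an
  M-subspace of `b` ALONE (no exactness) `W_b(x)` is the sum of `(-1)^{b(z)+z·x}` over the `z` whose coset matches
  `x`; for bent `b` with a FULL M-subspace the dual is evaluable pointwise and `Φ(a,b)` is an exactly samplable
  `±1` expectation for ANY partner `a` — the readout for the band's bent-half stratum, offered to `stub_band`.

The five REGISTERED STUBS (sorried; everything else is proved):

* `stub_flatSearch` — FLAT SEARCH ∈ FBPP (XL, OPEN, the line's HARDEST own stub; = the card's transfer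
  `C⁺ = SEED ∧ G` stated by its OUTPUT, which is all the readout consumes): an `FP` function on
  `⟨instance, coins⟩` that, on every exact cubic two-circuit instance, outputs with probability `≥ 1/2` an
  affine flat `v ⊕ F` of `b = C₁` with `|F|·(n+1)^c ≥ 2^{n/2}` (`GoodFlat`; output format `blockAt`/
  `dirOf`; `spanOf` is a subspace: `zeroVec_mem_spanOf`, `bxor_mem_spanOf`). Road: SEED (a non-zero vector
  of `E_a ∪ E_b`: first-polar radicals, card polar-radical-seeds — Seed Lemma TRUE, triage) ⇒ ping-pong
  closure (sound: `pingPong`; generic completion `G` OPEN; kit j007719: closure = one round on 42/42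
  trials, n ≤ 36) ⇒ re-seed per block on direct sums (Gold^{⊕k}) ⇒ verify (affinity of a cubic on a flat
  is poly-time checkable, so ANY seed source plugs in: MeatAxe on `T_a∘T_b`, block centroid). Why it might
  FAIL: r3 true — exact cubic pairs whose large affine flats are hard to find (indecomposable biquadratic
  `π` without affine component beyond the Gold cube, existence open, j007743; non-MM# cubic/cubic exact
  pairs, i.e. `¬ExactPairsMaioranaMcFarland`, possibly with NO flat of co-dimension `O(log n)` at all).
* `stub_exactReadout` — `FlatSearch → signedExactCubicForrelationProblem 2 ∈ PromiseBPP'` (L, TRUE on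
  paper): amplify the finder (first verified flat among `O(1)` independent runs), solve `w` (Gaussian
  elimination: the linear part of `b` on `v ⊕ F`), sample `y ∈ w ⊕ F^⊥` from uniform coins (basis of `F^⊥`),
  average `(-1)^{a(y)+v·y}` over `O((n+1)^{2c})` samples, compare with `(-1)^{b(v)}` — correctness is
  `partialSign_affine` + Chebyshev (`SamplingChebyshev`), membership by `mem_PromiseBPP'_of_fp_decider`;
  risk purely formal (FP/TM plumbing as in `CubicForrelationEstimatorMachine`).
* `stub_isolation` — VERBATIM the route item r2 `NearExactIsExact` (stmt-QuantumAdvantage-14043; shared,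
  not re-filed): `∃ θ < 1`, `Φ > θ ⇒ Φ = 1` for cubic pairs on evenly many bits. It is what separates the
  exact slice from the band by MAGNITUDE (gap `1 - θ²` for the landed `Φ²` estimator); without a magnitude
  gap the split is unsound (a NO instance `(b̃ ⊕ 1 ⊕ e, b)` with `wt e < 2ⁿ/5` can spoil EVERY coset sum of
  a flat: `#cosets = 2^{n/2-t} < 2^{n/2+1}/5`), see the line card.
* `stub_band` — the signed problem OFF the exact slice (`signedBandProblem`: YES `3/5 ≤ Φ < 1`, NO
  `-1 < Φ ≤ -3/5`) is in `PromiseBPP'` (XL, OPEN, FOREIGN residual: the structure conjecture + Lagrangian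
  estimator of the block programme, cards coset-web-block-peeling / lagrangian-splitting /
  transpose-defect-locator; every band instance on file — P₄, the n = 8 pair, T-family, P₂⊗T, T^{⊗k} — is
  decomposable with blockwise-trivial sign). This line contributes to it only the exact-core ANCHOR
  (`stub_flatSearch` + `partialSign_affine` on a block).
* `stub_unionLift` — `NearExactIsExact → exact slice ∈ PromiseBPP' → band ∈ PromiseBPP' → S` (L, TRUE on
  paper): with `θ` from isolation every in-promise non-exact instance has `|Φ| ≤ max θ (3/5)` (negative
  side through `IsDegLeFun.not` / `forrelation_not_right`; `|Φ| ≤ 1` is `KForrelationInstance.abs_value_le_one`),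
  so `Mag := (Φ² = 1 vs Φ² ≤ θ₀²)` is in `PromiseBPP'` by the landed `Φ²` estimator re-instantiated at gap
  `1 - θ₀²` (`CubicDequant`, `N = O((1-θ₀²)^{-2})`); then `S = (Y_ex, N) ∨ (Y_band, N)` with
  `(Y_ex, N) = (Y_ex, N_ex) ∧ (Y_ex, N_band)`, `(Y_band, N) = (Y_band, N_band) ∧ (Y_band, N_ex)`, the cross
  problems being sub-promises of `Mag` / `Mag.swap` — AND/OR closure of `PromiseBPP'` (amplification
  `exists_amplifier_of_mem_PromiseBPP'` + independent coin halves), `mem_PromiseBPP'_of_subset`,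
  `swap_mem_PromiseBPP'`.

`SignedCubicForrelationInPrBPP_of` composes the five stubs into the crux BY NAME (kernel-checked, no
`sorry`; last step `rfl`); `not_signedExactNotPrBPP_of` records the intermediate payoff: `stub_flatSearch`
and `stub_exactReadout` ALONE refute the route's crux r3 `SignedExactCubicForrelationNotPrBPP`
(stmt-QuantumAdvantage-13932) — the line's first milestone, independent of isolation and of the band.

## Disproof used (`Cruxes/SignedCubicForrelationInPrBPP/Disproof.lean`, cdisprove v2) and landed Negatives

* §0 `crux_eq` — USED: the composition ends in `signedCubicForrelationProblem 2 ∈ PromiseBPP'`, the crux by `rfl`.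
* §2 (no `_false_without_` theorem exists for this crux; monotone lattice) — HONOURED: the line keeps
  `Even n`, degree `≤ 3` and the class `PromiseBPP'`; `crux_of_threshold` runs the wrong way for the band,
  which is why the band is an explicit stub and not a threshold argument; `crux_imp_not_signedExact` is the
  converse of our milestone (the exact slice is a NECESSARY sub-goal — not a costume).
* §3a `no_negAt_invariant_decider` — HONOURED at `stub_exactReadout`: the decider evaluates `a` on a coset
  and compares with `(-1)^{b(v)}`; under `negAt 1` (`b ↦ ¬b`) the comparison bit flips, as it must.
* §3b `not_biquadraticPermsHaveAffineComponent` (landed `Negative/GoldCube.lean`) — HONOURED: no stub asks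
  for an affine component / triangular `π`; on the Gold-cube pair ping-pong closes in one round and the
  M-subspace is unique (triage certificates GoldPair.lean / GoldRad.lean).
* §3c `fsum_mul_cross_eq` (landed `Negative/CrossCorrelation.lean`) — CONSISTENT: `partialSign` is its
  structured cousin (transport along the flat-indicator anchor, whose partner value is known EXACTLY), so
  the line works in §3c's declared hard regime (both halves far from quadratics).
* Landed `Theorems/CubicForrelationInPrBPP/Negative/FlatSign.lean` — the `t = 0`, `v = 0` case of
  `partialSign_affine`; imported, not restated as a stub.
* `ledger negatives --problem QuantumAdvantage` (5): only `CubicStability` (stmt-2202, P₄) is related; NO stub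
  here claims localisation at `3/5` — the band is a separate stub, and P₄ itself is decided by a defect-0
  flag (triage r1-2 App. B). No stub is an instance a landed Negative lemma refutes.
-/

noncomputable section

set_option linter.dupNamespace false

namespace Summit.QuantumAdvantage.QuantumAdvantage.Cruxes.SignedCubicForrelationInPrBPP.SeedToSign

open Finset
open Literature.Computability.Complexity Literature.Computability.QuantumComplexity
open Literature.Computability.QuantumComplexity.BuzetChailloux (bxor zeroVec bxorPerm bxorPerm_apply
  bxor_bxor_cancel_left bxor_zeroVec bxor_comm bxor_eq_zeroVec_iff twist_bxor_right twist_zeroVec_right signOf_sq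
  phi_signOf)
open Literature.Computability.QuantumComplexity.Simon (twist_sq twist_eq_one_or twist_mul_self sum_twist)
open Literature.Computability.QuantumComplexity.DerivativeWalsh
open Summit.QuantumAdvantage.QuantumAdvantage.Theses.CubicForrelation

variable {n : ℕ}

/-! ### Vocabulary: finsets of bit vectors as subspaces / flats; decoding a finder's output -/

/-- `F ⊆ 𝔽₂ⁿ` is a linear subspace: contains `0`, closed under `⊕`. -/
def IsSubspace (F : Finset (Fin n → Bool)) : Prop :=
  zeroVec ∈ F ∧ ∀ e ∈ F, ∀ e' ∈ F, bxor e e' ∈ F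

/-- `g` is AFFINE on the coset `v ⊕ F`: all second differences of `g` along `F`, based at `v`, vanish. -/
def IsAffineOnCoset (g : (Fin n → Bool) → Bool) (v : Fin n → Bool) (F : Finset (Fin n → Bool)) : Prop :=
  ∀ y ∈ F, ∀ y' ∈ F, (g (bxor v (bxor y y')) ^^ g (bxor v y) ^^ g (bxor v y') ^^ g v) = false

/-- `E` is an M-SUBSPACE of `g` (Dillon): `g` is affine on EVERY coset of `E` — the hypothesis shape of the
landed duality `DerivativeWalsh.dual_affine_on_perp_cosets`. -/
def IsMSubspace (g : (Fin n → Bool) → Bool) (E : Finset (Fin n → Bool)) : Prop :=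
  ∀ u ∈ E, ∀ v ∈ E, ∀ y, (g y ^^ g (bxor y u) ^^ g (bxor y v) ^^ g (bxor y (bxor u v))) = false

/-- The `k`-th `n`-bit block of a bit string (zero-padded). Output convention of the finder:
block `0` = the shift `v`, blocks `1 … ⌊|s|/n⌋ - 1` = generators of the direction space `F`. -/
def blockAt (n : ℕ) (s : List Bool) (k : ℕ) : Fin n → Bool := fun i => s.getD (k * n + i) false

/-- The `⊕`-span of a list of vectors, as a finset. -/
def spanOf : List (Fin n → Bool) → Finset (Fin n → Bool)
  | [] => {zeroVec}
  | e :: es => spanOf es ∪ (spanOf es).image (bxor e)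

/-- The shift `v` read from a finder's output. -/
def shiftOf (n : ℕ) (s : List Bool) : Fin n → Bool := blockAt n s 0

/-- The direction space `F` read from a finder's output. -/
def dirOf (n : ℕ) (s : List Bool) : Finset (Fin n → Bool) :=
  spanOf ((List.range (s.length / n - 1)).map fun k => blockAt n s (k + 1))

/-- The output `s` of a finder is a GOOD FLAT of slack `c` for the two-circuit instance `I`: the second
function `g = C₁` (`CubicDequant.gI`) is affine on the coset `v ⊕ F` read from `s`, and
`|F| · (n+1)^c ≥ 2^{n/2}` (squared, to stay in `ℕ`): an affine flat of `g` of CO-DIMENSION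
`t ≤ c·log₂(n+1)` inside the half dimension. -/
def GoodFlat (I : KForrelationInstance) (hk : I.k = 2) (c : ℕ) (s : List Bool) : Prop :=
  IsAffineOnCoset (CubicDequant.gI I hk) (shiftOf I.n s) (dirOf I.n s) ∧
    2 ^ I.n ≤ (dirOf I.n s).card ^ 2 * (I.n + 1) ^ (2 * c)

/-- `0 ∈ spanOf l`. -/
theorem zeroVec_mem_spanOf : ∀ l : List (Fin n → Bool), zeroVec ∈ spanOf l
  | [] => by simp [spanOf]
  | e :: es => by
    rw [spanOf]
    exact mem_union_left _ (zeroVec_mem_spanOf es)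

/-- `spanOf l` is closed under `⊕`. -/
theorem bxor_mem_spanOf : ∀ l : List (Fin n → Bool), ∀ x ∈ spanOf l, ∀ y ∈ spanOf l, bxor x y ∈ spanOf l
  | [] => by
    intro x hx y hy
    simp only [spanOf, mem_singleton] at hx hy ⊢
    subst hx; subst hy
    exact bxor_zeroVec _
  | e :: es => by
    intro x hx y hy
    have ih := bxor_mem_spanOf es
    have hl : ∀ p q r : Fin n → Bool, bxor p (bxor q r) = bxor q (bxor p r) := by
      intro p q r; funext i; simp only [bxor]; cases p i <;> cases q i <;> cases r i <;> rfl
    have ha : ∀ p q r : Fin n → Bool, bxor (bxor q p) r = bxor q (bxor p r) := by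
      intro p q r; funext i; exact Bool.xor_assoc (q i) (p i) (r i)
    have hc : ∀ p q r : Fin n → Bool, bxor (bxor r p) (bxor r q) = bxor p q := by
      intro p q r; funext i; simp only [bxor]; cases p i <;> cases q i <;> cases r i <;> rfl
    rw [spanOf] at hx hy ⊢
    rcases mem_union.1 hx with hx | hx <;> rcases mem_union.1 hy with hy | hy
    · exact mem_union_left _ (ih x hx y hy)
    · obtain ⟨y', hy', rfl⟩ := mem_image.1 hy
      refine mem_union_right _ (mem_image.2 ⟨bxor x y', ih x hx y' hy', ?_⟩)
      rw [hl]
    · obtain ⟨x', hx', rfl⟩ := mem_image.1 hx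
      refine mem_union_right _ (mem_image.2 ⟨bxor x' y, ih x' hx' y hy, ?_⟩)
      rw [ha]
    · obtain ⟨x', hx', rfl⟩ := mem_image.1 hx
      obtain ⟨y', hy', rfl⟩ := mem_image.1 hy
      refine mem_union_left _ ?_
      rw [hc]
      exact ih x' hx' y' hy'

/-- The direction space read from ANY output string is a subspace (so `GoodFlat` need not demand it). -/
theorem isSubspace_dirOf (n : ℕ) (s : List Bool) : IsSubspace (dirOf n s) :=
  ⟨zeroVec_mem_spanOf _, bxor_mem_spanOf _⟩

/-! ### Lever 1 (PROVED): ping-pong — closure soundness -/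

/-- **Ping-pong.** For an EXACT pair (`Φ(f,g)² = 1`) and an M-subspace `E` of `g` with `|E|² = 2ⁿ`, every
`ξ ∈ E^⊥` has its derivative row `u ↦ T_f(ξ,u) = ∑_x f(x) f(x ⊕ ξ) (-1)^{u·x}` (`DerivativeWalsh.dwt`, `f`
read in `±1`) supported INSIDE `E`. -/
def PingPong : Prop :=
  ∀ (n : ℕ) (f g : (Fin n → Bool) → Bool) (E : Finset (Fin n → Bool)),
    forrelation f g ^ 2 = 1 → zeroVec ∈ E → (∀ e ∈ E, ∀ e' ∈ E, bxor e e' ∈ E) →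
    ((E.card : ℝ) ^ 2 = (2 : ℝ) ^ n) → IsMSubspace g E →
    ∀ ξ : Fin n → Bool, (∀ e ∈ E, twist e ξ = 1) →
      ∀ u : Fin n → Bool, u ∉ E → dwt (fun x => signOf (f x)) ξ u = 0

/-- **`PingPong` holds** (from the landed duality `dual_affine_on_perp_cosets`: `f` is affine on the cosets
of `E^⊥`, so `x ↦ f(x)f(x ⊕ ξ)` is `E^⊥`-periodic, and an `E^⊥`-periodic function has Walsh support in
`E^⊥⊥ = E` — `perp_perp_eq_of_sq`). -/
theorem pingPong : PingPong := by
  intro n f g E hΦ h0 hadd hcard hM ξ hξ u hu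
  -- `Φ = ±1`
  have hΦ' : forrelation f g = 1 ∨ forrelation f g = -1 := by
    have hm : (forrelation f g - 1) * (forrelation f g + 1) = 0 := by ring_nf; linarith [hΦ]
    rcases mul_eq_zero.1 hm with h1 | h1
    · exact Or.inl (by linarith)
    · exact Or.inr (by linarith)
  obtain ⟨hP0, hPadd⟩ := bxor_mem_perp E
  obtain ⟨hpp, hPcard⟩ := perp_perp_eq_of_sq h0 hadd hcard
  have hξP : ξ ∈ (univ.filter fun y => ∀ x ∈ E, twist x y = 1) := mem_filter.2 ⟨mem_univ _, hξ⟩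
  -- the derivative `x ↦ f(x) f(x ⊕ ξ)` (in `±1`) is invariant under translation by `E^⊥`
  have hD : ∀ x, ∀ e ∈ (univ.filter fun y => ∀ x ∈ E, twist x y = 1),
      signOf (f (bxor x e)) * signOf (f (bxor (bxor x e) ξ)) = signOf (f x) * signOf (f (bxor x ξ)) := by
    intro x e he
    obtain ⟨r, hr⟩ := dual_affine_on_perp_cosets hΦ' h0 hadd hcard hM x
    have he' := hr e he
    have hξ' := hr ξ hξP
    have heξ := hr (bxor e ξ) (hPadd e he ξ hξP)
    have hassoc : bxor (bxor x e) ξ = bxor x (bxor e ξ) := by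
      funext i; exact Bool.xor_assoc (x i) (e i) (ξ i)
    rw [hassoc]
    have t1 := twist_mul_self e r
    have hte : twist (bxor e ξ) r = twist e r * twist ξ r := twist_bxor_left e ξ r
    have e1 : signOf (f (bxor x e)) = signOf (f x) * twist e r := by
      calc signOf (f (bxor x e)) = signOf (f (bxor x e)) * (twist e r * twist e r) := by rw [t1, mul_one]
        _ = (signOf (f (bxor x e)) * twist e r) * twist e r := by ring
        _ = signOf (f x) * twist e r := by rw [he']
    have e2 : signOf (f (bxor x ξ)) = signOf (f x) * twist ξ r := by
      have t2 := twist_mul_self ξ r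
      calc signOf (f (bxor x ξ)) = signOf (f (bxor x ξ)) * (twist ξ r * twist ξ r) := by rw [t2, mul_one]
        _ = (signOf (f (bxor x ξ)) * twist ξ r) * twist ξ r := by ring
        _ = signOf (f x) * twist ξ r := by rw [hξ']
    have e3 : signOf (f (bxor x (bxor e ξ))) = signOf (f x) * (twist e r * twist ξ r) := by
      have t3 := twist_mul_self (bxor e ξ) r
      calc signOf (f (bxor x (bxor e ξ)))
          = signOf (f (bxor x (bxor e ξ))) * (twist (bxor e ξ) r * twist (bxor e ξ) r) := by
              rw [t3, mul_one]
        _ = (signOf (f (bxor x (bxor e ξ))) * twist (bxor e ξ) r) * twist (bxor e ξ) r := by ring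
        _ = signOf (f x) * (twist e r * twist ξ r) := by rw [heξ, hte]
    rw [e1, e2, e3]
    calc signOf (f x) * twist e r * (signOf (f x) * (twist e r * twist ξ r))
        = signOf (f x) * signOf (f x) * twist ξ r * (twist e r * twist e r) := by ring
      _ = signOf (f x) * (signOf (f x) * twist ξ r) := by rw [t1]; ring
  -- the row sum reproduces itself with the factor `(-1)^{u·e}` for every `e ∈ E^⊥`
  have hS : ∀ e ∈ (univ.filter fun y => ∀ x ∈ E, twist x y = 1),
      dwt (fun x => signOf (f x)) ξ u = twist u e * dwt (fun x => signOf (f x)) ξ u := by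
    intro e he
    simp only [dwt]
    calc ∑ x, signOf (f x) * signOf (f (bxor x ξ)) * twist u x
        = ∑ x, signOf (f (bxor e x)) * signOf (f (bxor (bxor e x) ξ)) * twist u (bxor e x) := by
          rw [← Equiv.sum_comp (bxorPerm e)
            (fun x => signOf (f x) * signOf (f (bxor x ξ)) * twist u x)]
          rfl
      _ = ∑ x, twist u e * (signOf (f x) * signOf (f (bxor x ξ)) * twist u x) := by
          refine sum_congr rfl fun x _ => ?_
          rw [bxor_comm e x, hD x e he, twist_bxor_right]
          ring
      _ = twist u e * ∑ x, signOf (f x) * signOf (f (bxor x ξ)) * twist u x := by rw [mul_sum]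
  -- some `e ∈ E^⊥` has `(-1)^{u·e} = -1`, because `u ∉ E = E^⊥⊥`
  obtain ⟨e, he, hne⟩ : ∃ e ∈ (univ.filter fun y => ∀ x ∈ E, twist x y = 1), twist e u ≠ 1 := by
    by_contra hall
    push Not at hall
    apply hu
    have hmem : u ∈ univ.filter (fun z => ∀ y ∈ (univ.filter fun y => ∀ x ∈ E, twist x y = 1),
        twist y z = 1) := mem_filter.2 ⟨mem_univ _, hall⟩
    rwa [hpp] at hmem
  have hneg : twist u e = -1 := by rw [twist_comm]; exact (twist_eq_one_or e u).resolve_left hne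
  have key := hS e he
  rw [hneg] at key
  linarith

/-- `signOf` is multiplicative over `xor`. -/
theorem signOf_xor' (a b : Bool) : signOf (a ^^ b) = signOf a * signOf b := by
  cases a <;> cases b <;> simp [signOf]

/-- **Duality in M-subspace form.** For an exact pair, the orthogonal of an M-subspace `E` of `g` (`|E|² = 2ⁿ`)
is an M-subspace of `f` (from `dual_affine_on_perp_cosets`): the closure may ping-pong in BOTH directions. -/
theorem isMSubspace_perp_of_exact {f g : (Fin n → Bool) → Bool} (hΦ : forrelation f g ^ 2 = 1)
    {E : Finset (Fin n → Bool)} (h0 : zeroVec ∈ E) (hadd : ∀ e ∈ E, ∀ e' ∈ E, bxor e e' ∈ E)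
    (hcard : (E.card : ℝ) ^ 2 = (2 : ℝ) ^ n) (hM : IsMSubspace g E) :
    IsMSubspace f (univ.filter fun y => ∀ x ∈ E, twist x y = 1) := by
  have hΦ' : forrelation f g = 1 ∨ forrelation f g = -1 := by
    have hm : (forrelation f g - 1) * (forrelation f g + 1) = 0 := by ring_nf; linarith [hΦ]
    rcases mul_eq_zero.1 hm with h1 | h1
    · exact Or.inl (by linarith)
    · exact Or.inr (by linarith)
  obtain ⟨hP0, hPadd⟩ := bxor_mem_perp E
  intro u hu v hv y
  obtain ⟨r, hr⟩ := dual_affine_on_perp_cosets hΦ' h0 hadd hcard hM y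
  have hu' := hr u hu
  have hv' := hr v hv
  have huv' := hr (bxor u v) (hPadd u hu v hv)
  have conv : ∀ z : Fin n → Bool, signOf (f (bxor y z)) * twist z r = signOf (f y) →
      signOf (f (bxor y z)) = signOf (f y) * twist z r := by
    intro z hz
    have t := twist_mul_self z r
    calc signOf (f (bxor y z)) = signOf (f (bxor y z)) * (twist z r * twist z r) := by rw [t, mul_one]
      _ = (signOf (f (bxor y z)) * twist z r) * twist z r := by ring
      _ = signOf (f y) * twist z r := by rw [hz]
  have e1 := conv u hu'
  have e2 := conv v hv'
  have e3 := conv (bxor u v) huv'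
  rw [twist_bxor_left] at e3
  have prod : signOf (f y) * signOf (f (bxor y u)) * signOf (f (bxor y v)) *
      signOf (f (bxor y (bxor u v))) = 1 := by
    rw [e1, e2, e3]
    have s := signOf_sq (f y)
    have t1 := twist_mul_self u r
    have t2 := twist_mul_self v r
    calc signOf (f y) * (signOf (f y) * twist u r) * (signOf (f y) * twist v r) *
          (signOf (f y) * (twist u r * twist v r))
        = signOf (f y) ^ 2 * signOf (f y) ^ 2 * (twist u r * twist u r) * (twist v r * twist v r) := by ring
      _ = 1 := by rw [s, t1, t2]; ring
  have hs : signOf (f y ^^ f (bxor y u) ^^ f (bxor y v) ^^ f (bxor y (bxor u v))) = 1 := by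
    rw [signOf_xor', signOf_xor', signOf_xor']
    exact prod
  cases hB : (f y ^^ f (bxor y u) ^^ f (bxor y v) ^^ f (bxor y (bxor u v)))
  · rfl
  · rw [hB] at hs
    norm_num [signOf] at hs

/-- `Φ(f,g) = Φ(g,f)`. -/
theorem forrelation_symm (f g : (Fin n → Bool) → Bool) : forrelation f g = forrelation g f := by
  rw [← phi_signOf, ← phi_signOf, phi_eq_fsum, phi_eq_fsum, fsum_eq_sum_mul_W', fsum_eq_sum_mul_W]

/-- **Ping-pong, the other direction.** In the situation of `pingPong`, every `e ∈ E` has its `g`-derivative row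
`u ↦ T_g(e,u)` supported INSIDE `E^⊥`: apply `pingPong` to `(g, f, E^⊥)` via `isMSubspace_perp_of_exact`,
`perp_perp_eq_of_sq` and `forrelation_symm`. -/
theorem pingPong_symm {f g : (Fin n → Bool) → Bool} (hΦ : forrelation f g ^ 2 = 1)
    {E : Finset (Fin n → Bool)} (h0 : zeroVec ∈ E) (hadd : ∀ e ∈ E, ∀ e' ∈ E, bxor e e' ∈ E)
    (hcard : (E.card : ℝ) ^ 2 = (2 : ℝ) ^ n) (hM : IsMSubspace g E) :
    ∀ e ∈ E, ∀ u : Fin n → Bool, u ∉ (univ.filter fun y => ∀ x ∈ E, twist x y = 1) →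
      dwt (fun y => signOf (g y)) e u = 0 := by
  intro e he u hu
  obtain ⟨hP0, hPadd⟩ := bxor_mem_perp E
  obtain ⟨-, hPcard⟩ := perp_perp_eq_of_sq h0 hadd hcard
  have hΦs : forrelation g f ^ 2 = 1 := by rw [forrelation_symm g f]; exact hΦ
  have hcardP : (((univ.filter fun y => ∀ x ∈ E, twist x y = 1).card : ℝ)) ^ 2 = (2 : ℝ) ^ n := by
    rw [hPcard]; exact hcard
  refine pingPong n g f _ hΦs hP0 hPadd hcardP (isMSubspace_perp_of_exact hΦ h0 hadd hcard hM) e ?_ u hu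
  intro e' he'
  rw [twist_comm]
  exact (mem_filter.1 he').2 e he

/-! ### Lever 2 (PROVED): the partial-flat sign identity, every co-dimension `t` -/

/-- `S(f,g) = S(g,f)`. -/
theorem fsum_symm (f g : (Fin n → Bool) → ℝ) : fsum f g = fsum g f := by
  rw [fsum_eq_sum_mul_W' f g, fsum_eq_sum_mul_W g f]

/-- **Partial-flat sign identity** (Poisson summation across `(F, F^⊥)` on an exact pair; the card's
`PartialSign`). For Boolean `a b` with `Φ(a,b)² = 1`, ANY finset `F` closed under `⊕` and any `v w`:
`|F| · ∑_{y ∈ w ⊕ F^⊥} (-1)^{a(y)} (-1)^{v·y} = √(2ⁿ) · Φ · ∑_{x ∈ F} (-1)^{x·w} (-1)^{b(v ⊕ x)}`.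
Proof: sign transport (`DerivativeWalsh.sign_transport`) for the re-randomised real pair
`x ↦ (-1)^{b(v ⊕ x)}`, `y ↦ (-1)^{a(y)} (-1)^{v·y}`, which has the same `S` as `(a, b)`. -/
theorem partialSign (a b : (Fin n → Bool) → Bool) (hΦ : forrelation a b ^ 2 = 1)
    {F : Finset (Fin n → Bool)} (hadd : ∀ x ∈ F, ∀ y ∈ F, bxor x y ∈ F) (v w : Fin n → Bool) :
    (F.card : ℝ) * ∑ y ∈ univ.filter (fun y => ∀ x ∈ F, twist x (bxor w y) = 1), signOf (a y) * twist v y =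
      Real.sqrt ((2 : ℝ) ^ n) * forrelation a b * ∑ x ∈ F, twist x w * signOf (b (bxor v x)) := by
  set P : (Fin n → Bool) → ℝ := fun x => signOf (b (bxor v x)) with hP
  set Q : (Fin n → Bool) → ℝ := fun y => signOf (a y) * twist v y with hQ
  have hP1 : ∀ x, P x ^ 2 = 1 := fun x => signOf_sq _
  have hQ1 : ∀ y, Q y ^ 2 = 1 := fun y => by
    rw [hQ]; simp only; rw [mul_pow, signOf_sq, twist_sq, one_mul]
  -- the re-randomised pair has the same forrelation sum as `(a, b)`
  have hPQ : fsum P Q = fsum (fun x => signOf (a x)) (fun y => signOf (b y)) := by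
    rw [fsum_symm (fun x => signOf (a x)), fsum, fsum]
    rw [← Equiv.sum_comp (bxorPerm v) (fun x => ∑ y, signOf (b x) * twist x y * signOf (a y))]
    refine sum_congr rfl fun x _ => sum_congr rfl fun y _ => ?_
    simp only [hP, hQ, bxorPerm_apply]
    rw [twist_bxor_left]
    ring
  have hS : fsum P Q ^ 2 = (8 : ℝ) ^ n := by
    rw [hPQ]; exact fsum_signOf_sq_of_forrelation_sq a b hΦ
  have key := sign_transport P Q hP1 hQ1 hS hadd w
  rw [hPQ, fsum_signOf_eq, sqrt_two_pow_three_mul] at key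
  have h2 : (0 : ℝ) < (2 : ℝ) ^ n := by positivity
  have key' : (2 : ℝ) ^ n * ((F.card : ℝ) *
      ∑ y ∈ univ.filter (fun y => ∀ x ∈ F, twist x (bxor w y) = 1), Q y) =
      (2 : ℝ) ^ n * (Real.sqrt ((2 : ℝ) ^ n) * forrelation a b * ∑ x ∈ F, twist x w * P x) := by
    rw [← mul_assoc]; rw [key]; ring
  have := mul_left_cancel₀ h2.ne' key'
  simpa [hP, hQ] using this

/-- **Readout form** (what `stub_exactReadout` samples). If moreover `0 ∈ F` and `b` is affine on the coset
`v ⊕ F` with linear part `w` — `(-1)^{x·w} (-1)^{b(v ⊕ x)} = (-1)^{b(v)}` for `x ∈ F` — then the twisted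
sum of `(-1)^a` over the dual coset `w ⊕ F^⊥` is EXACTLY `√(2ⁿ) · Φ · (-1)^{b(v)}`: `2ⁿ/|F|` signs of mean
`Φ (-1)^{b(v)} |F| 2^{-n/2}`, i.e. relative bias `2^{-t}` when `|F| = 2^{n/2-t}`. -/
theorem partialSign_affine (a b : (Fin n → Bool) → Bool) (hΦ : forrelation a b ^ 2 = 1)
    {F : Finset (Fin n → Bool)} (h0 : zeroVec ∈ F) (hadd : ∀ x ∈ F, ∀ y ∈ F, bxor x y ∈ F)
    (v w : Fin n → Bool) (haff : ∀ x ∈ F, twist x w * signOf (b (bxor v x)) = signOf (b v)) :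
    ∑ y ∈ univ.filter (fun y => ∀ x ∈ F, twist x (bxor w y) = 1), signOf (a y) * twist v y =
      Real.sqrt ((2 : ℝ) ^ n) * forrelation a b * signOf (b v) := by
  have key := partialSign a b hΦ hadd v w
  rw [sum_congr rfl haff, sum_const, nsmul_eq_mul] at key
  have hF : (0 : ℝ) < F.card := by exact_mod_cast card_pos.2 ⟨_, h0⟩
  have key' : (F.card : ℝ) * ∑ y ∈ univ.filter (fun y => ∀ x ∈ F, twist x (bxor w y) = 1),
      signOf (a y) * twist v y =
      (F.card : ℝ) * (Real.sqrt ((2 : ℝ) ^ n) * forrelation a b * signOf (b v)) := by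
    rw [key]; ring
  exact mul_left_cancel₀ hF.ne' key'

/-! ### From a good flat to the readout hypothesis (PROVED): the linear part of an affine restriction -/

/-- Every `±1`-valued multiplicative character of a subspace `F ⊆ 𝔽₂ⁿ` is `x ↦ (-1)^{x·w}` for some `w`
(count `∑_w (∑_{x∈F} χ(x)(-1)^{x·w})²` two ways: `2ⁿ|F|` by orthogonality of characters, `K·|F|²` by
`sum_char_subspace`; so `K = 2ⁿ/|F| ≥ 1`). -/
theorem exists_twist_eq_char {F : Finset (Fin n → Bool)} (hF : IsSubspace F) (χ : (Fin n → Bool) → ℝ)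
    (hsq : ∀ x ∈ F, χ x = 1 ∨ χ x = -1) (hmul : ∀ x ∈ F, ∀ x' ∈ F, χ (bxor x x') = χ x * χ x') :
    ∃ w : Fin n → Bool, ∀ x ∈ F, χ x * twist x w = 1 := by
  -- each twisted character sums to `|F|` or `0`
  have hinner : ∀ w, ∑ x ∈ F, χ x * twist x w = F.card ∨ ∑ x ∈ F, χ x * twist x w = 0 := by
    intro w
    refine sum_char_subspace hF.2 (fun x => χ x * twist x w) ?_ ?_
    · intro x hx
      rcases hsq x hx with h | h <;> rcases twist_eq_one_or x w with h' | h' <;> simp [h, h']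
    · intro x hx x' hx'
      show χ (bxor x x') * twist (bxor x x') w = χ x * twist x w * (χ x' * twist x' w)
      rw [hmul x hx x' hx', twist_bxor_left]
      ring
  -- the total second moment is `2ⁿ |F|`
  have htot : ∑ w : Fin n → Bool, (∑ x ∈ F, χ x * twist x w) ^ 2 = (2 : ℝ) ^ n * F.card := by
    have e1 : ∀ w : Fin n → Bool, (∑ x ∈ F, χ x * twist x w) ^ 2 =
        ∑ x ∈ F, ∑ x' ∈ F, χ x * χ x' * twist (bxor x x') w := by
      intro w
      rw [sq, sum_mul_sum]
      refine sum_congr rfl fun x _ => sum_congr rfl fun x' _ => ?_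
      rw [twist_bxor_left]; ring
    simp_rw [e1]
    rw [sum_comm]
    have e2 : ∀ x ∈ F, ∑ w : Fin n → Bool, ∑ x' ∈ F, χ x * χ x' * twist (bxor x x') w = (2 : ℝ) ^ n := by
      intro x hx
      rw [sum_comm]
      have e3 : ∀ x' ∈ F, ∑ w : Fin n → Bool, χ x * χ x' * twist (bxor x x') w =
          if x' = x then (2 : ℝ) ^ n else 0 := by
        intro x' hx'
        rw [← mul_sum, sum_twist (bxor x x')]
        by_cases h : x' = x
        · subst h
          rw [if_pos (by funext i; simp [bxor]), if_pos rfl]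
          rcases hsq x' hx' with h1 | h1 <;> rw [h1] <;> ring
        · rw [if_neg, if_neg h, mul_zero]
          intro h0
          apply h
          have : bxor x x' = zeroVec := h0
          exact ((bxor_eq_zeroVec_iff x x').1 this).symm
      rw [sum_congr rfl e3, sum_ite_eq' F x, if_pos hx]
    rw [sum_congr rfl e2, sum_const, nsmul_eq_mul, mul_comm]
  -- hence some `w` has the full inner sum
  obtain ⟨w, hw⟩ : ∃ w, ∑ x ∈ F, χ x * twist x w = F.card := by
    by_contra hall
    push Not at hall
    have hz : ∀ w, ∑ x ∈ F, χ x * twist x w = 0 := fun w => (hinner w).resolve_left (hall w)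
    have : ∑ w : Fin n → Bool, (∑ x ∈ F, χ x * twist x w) ^ 2 = 0 := by simp [hz]
    rw [htot] at this
    have hF0 : (0 : ℝ) < F.card := by exact_mod_cast card_pos.2 ⟨_, hF.1⟩
    have : (0 : ℝ) < (2 : ℝ) ^ n * F.card := by positivity
    linarith
  refine ⟨w, all_eq_of_sum_eq_card F (fun x => χ x * twist x w) ?_ 1 (Or.inl rfl) (by rw [one_mul]; exact hw)⟩
  intro x hx
  rcases hsq x hx with h | h <;> rcases twist_eq_one_or x w with h' | h' <;> simp [h, h']

/-- **Linear part of an affine restriction.** If `b` is affine on the coset `v ⊕ F` of a subspace `F`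
(`IsAffineOnCoset`, the shape a finder's output is verified in), some `w` represents its linear part:
`(-1)^{x·w} (-1)^{b(v ⊕ x)} = (-1)^{b(v)}` for all `x ∈ F` — exactly the hypothesis `haff` of `partialSign_affine`. -/
theorem exists_linearPart (b : (Fin n → Bool) → Bool) (v : Fin n → Bool) {F : Finset (Fin n → Bool)}
    (hF : IsSubspace F) (haff : IsAffineOnCoset b v F) :
    ∃ w : Fin n → Bool, ∀ x ∈ F, twist x w * signOf (b (bxor v x)) = signOf (b v) := by
  set χ : (Fin n → Bool) → ℝ := fun x => signOf (b (bxor v x)) * signOf (b v) with hχ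
  have hsq : ∀ x ∈ F, χ x = 1 ∨ χ x = -1 := by
    intro x _
    simp only [hχ]
    rcases Bool.eq_false_or_eq_true (b (bxor v x)) with h | h <;>
      rcases Bool.eq_false_or_eq_true (b v) with h' | h' <;> simp [signOf, h, h']
  have hmul : ∀ x ∈ F, ∀ x' ∈ F, χ (bxor x x') = χ x * χ x' := by
    intro x hx x' hx'
    have h4 := haff x hx x' hx'
    simp only [hχ]
    rcases Bool.eq_false_or_eq_true (b (bxor v (bxor x x'))) with e1 | e1 <;>
      rcases Bool.eq_false_or_eq_true (b (bxor v x)) with e2 | e2 <;>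
        rcases Bool.eq_false_or_eq_true (b (bxor v x')) with e3 | e3 <;>
          rcases Bool.eq_false_or_eq_true (b v) with e4 | e4 <;>
            simp only [e1, e2, e3, e4] at h4 ⊢ <;> simp [signOf] at h4 ⊢
  obtain ⟨w, hw⟩ := exists_twist_eq_char hF χ hsq hmul
  refine ⟨w, fun x hx => ?_⟩
  have h1 := hw x hx
  simp only [hχ] at h1
  have h2 := signOf_sq (b v)
  calc twist x w * signOf (b (bxor v x))
      = twist x w * signOf (b (bxor v x)) * (signOf (b v) ^ 2) := by rw [h2, mul_one]
    _ = (signOf (b (bxor v x)) * signOf (b v) * twist x w) * signOf (b v) := by ring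
    _ = signOf (b v) := by rw [h1, one_mul]

/-- **The readout's exact mean, from a verified flat** (all the mathematics of `stub_exactReadout`; what is
left there is sampling + machine plumbing): for an exact pair, a subspace `F` and a coset `v ⊕ F` on which `b`
is affine, SOME dual coset `w ⊕ F^⊥` (with `w` computable by Gaussian elimination, `exists_linearPart`) has
`∑_{y ∈ w ⊕ F^⊥} (-1)^{a(y)} (-1)^{v·y} = √(2ⁿ) · Φ · (-1)^{b(v)}`: `2ⁿ/|F|` signs of mean `Φ (-1)^{b(v)} |F| 2^{-n/2}`. -/
theorem readout_of_affineFlat (a b : (Fin n → Bool) → Bool) (hΦ : forrelation a b ^ 2 = 1)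
    {F : Finset (Fin n → Bool)} (hF : IsSubspace F) (v : Fin n → Bool) (haff : IsAffineOnCoset b v F) :
    ∃ w : Fin n → Bool, (∀ x ∈ F, twist x w * signOf (b (bxor v x)) = signOf (b v)) ∧
      ∑ y ∈ univ.filter (fun y => ∀ x ∈ F, twist x (bxor w y) = 1), signOf (a y) * twist v y =
        Real.sqrt ((2 : ℝ) ^ n) * forrelation a b * signOf (b v) := by
  obtain ⟨w, hw⟩ := exists_linearPart b v hF haff
  exact ⟨w, hw, partialSign_affine a b hΦ hF.1 hF.2 v w hw⟩

/-! ### Tool for the band's bent-half stratum (PROVED): the dual-value formula (triage r1-3, gen 2) -/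

/-- **Dual-value formula.** If `g` is affine on the cosets of a `⊕`-closed `E ∋ 0` (`IsMSubspace`; NO bentness,
NO half-dimension needed), then for EVERY `x` the Walsh coefficient `W_g(x) = ∑_y (-1)^{g(y)+y·x}` equals the sum,
over the `z` whose coset has linear part matching `x` on `E`, of `(-1)^{g(z) + z·x}`. For bent `g` with
`|E| = 2^{n/2}` exactly `|E|` values of `z` match each `x` and `W_g(x) = 2^{n/2}(-1)^{g̃(x)}`: the dual is
EVALUABLE pointwise from a full M-subspace (one linear solve per point). -/
theorem W_eq_sum_matched (g : (Fin n → Bool) → Bool) {E : Finset (Fin n → Bool)} (h0 : zeroVec ∈ E)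
    (hadd : ∀ e ∈ E, ∀ e' ∈ E, bxor e e' ∈ E) (hM : IsMSubspace g E) (x : Fin n → Bool) :
    W (fun y => signOf (g y)) x =
      ∑ z, if (∀ e ∈ E, signOf (g (bxor z e)) * signOf (g z) * twist x e = 1)
        then signOf (g z) * twist z x else 0 := by
  classical
  -- the character of `E` attached to the coset of `z`, twisted by `x`: trivial (sum `|E|`) or not (sum `0`)
  have hchar : ∀ z, (∑ e ∈ E, signOf (g (bxor z e)) * signOf (g z) * twist x e = E.card ∧
        (∀ e ∈ E, signOf (g (bxor z e)) * signOf (g z) * twist x e = 1)) ∨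
      (∑ e ∈ E, signOf (g (bxor z e)) * signOf (g z) * twist x e = 0 ∧
        ¬ (∀ e ∈ E, signOf (g (bxor z e)) * signOf (g z) * twist x e = 1)) := by
    intro z
    have hsq : ∀ e ∈ E, signOf (g (bxor z e)) * signOf (g z) * twist x e = 1 ∨
        signOf (g (bxor z e)) * signOf (g z) * twist x e = -1 := by
      intro e _
      rcases Bool.eq_false_or_eq_true (g (bxor z e)) with h1 | h1 <;>
        rcases Bool.eq_false_or_eq_true (g z) with h2 | h2 <;>
          rcases twist_eq_one_or x e with h3 | h3 <;> simp [signOf, h1, h2, h3]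
    have hmul : ∀ u ∈ E, ∀ v ∈ E,
        signOf (g (bxor z (bxor u v))) * signOf (g z) * twist x (bxor u v) =
          (signOf (g (bxor z u)) * signOf (g z) * twist x u) *
            (signOf (g (bxor z v)) * signOf (g z) * twist x v) := by
      intro u hu v hv
      have h4 := hM u hu v hv z
      rw [twist_bxor_right]
      have key : signOf (g (bxor z (bxor u v))) =
          signOf (g z) * signOf (g (bxor z u)) * signOf (g (bxor z v)) := by
        rcases Bool.eq_false_or_eq_true (g (bxor z (bxor u v))) with e1 | e1 <;>
          rcases Bool.eq_false_or_eq_true (g (bxor z u)) with e2 | e2 <;>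
            rcases Bool.eq_false_or_eq_true (g (bxor z v)) with e3 | e3 <;>
              rcases Bool.eq_false_or_eq_true (g z) with e4 | e4 <;>
                simp only [e1, e2, e3, e4] at h4 ⊢ <;> simp [signOf] at h4 ⊢
      rw [key]
      ring
    rcases sum_char_subspace hadd (fun e => signOf (g (bxor z e)) * signOf (g z) * twist x e) hsq hmul with
      h | h
    · left
      refine ⟨h, ?_⟩
      exact all_eq_of_sum_eq_card E _ hsq 1 (Or.inl rfl) (by rw [one_mul]; exact h)
    · right
      refine ⟨h, fun hall => ?_⟩
      have : ∑ e ∈ E, signOf (g (bxor z e)) * signOf (g z) * twist x e = E.card := by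
        rw [sum_congr rfl hall, sum_const, nsmul_eq_mul, mul_one]
      rw [this] at h
      have hE : (0 : ℝ) < E.card := by exact_mod_cast card_pos.2 ⟨_, h0⟩
      linarith
  -- each coset sum of `(-1)^{g(y)+y·x}` is `|E|` times the matched summand
  have hcoset : ∀ z, ∑ e ∈ E, signOf (g (bxor z e)) * twist (bxor z e) x =
      (E.card : ℝ) * (if (∀ e ∈ E, signOf (g (bxor z e)) * signOf (g z) * twist x e = 1)
        then signOf (g z) * twist z x else 0) := by
    intro z
    have e1 : ∀ e ∈ E, signOf (g (bxor z e)) * twist (bxor z e) x =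
        signOf (g z) * twist z x * (signOf (g (bxor z e)) * signOf (g z) * twist x e) := by
      intro e _
      rw [twist_bxor_left, twist_comm e x]
      have s := signOf_sq (g z)
      calc signOf (g (bxor z e)) * (twist z x * twist x e)
          = signOf (g (bxor z e)) * (twist z x * twist x e) * signOf (g z) ^ 2 := by rw [s, mul_one]
        _ = _ := by ring
    rw [sum_congr rfl e1, ← mul_sum]
    rcases hchar z with ⟨hs, hm⟩ | ⟨hs, hm⟩
    · rw [hs, if_pos hm]; ring
    · rw [hs, if_neg hm]; ring
  -- sum over `z`, then undo the `|E|`-fold overcount by reindexing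
  have hE : (0 : ℝ) < E.card := by exact_mod_cast card_pos.2 ⟨_, h0⟩
  have htot : ∑ z, ∑ e ∈ E, signOf (g (bxor z e)) * twist (bxor z e) x =
      (E.card : ℝ) * W (fun y => signOf (g y)) x := by
    rw [sum_comm]
    have e2 : ∀ e ∈ E, ∑ z, signOf (g (bxor z e)) * twist (bxor z e) x = W (fun y => signOf (g y)) x := by
      intro e _
      rw [W]
      rw [← Equiv.sum_comp (bxorPerm e) (fun y => signOf (g y) * twist y x)]
      refine sum_congr rfl fun z _ => ?_
      simp only [bxorPerm_apply]
      rw [bxor_comm e z]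
    rw [sum_congr rfl e2, sum_const, nsmul_eq_mul]
  have key : (E.card : ℝ) * W (fun y => signOf (g y)) x =
      (E.card : ℝ) * ∑ z, (if (∀ e ∈ E, signOf (g (bxor z e)) * signOf (g z) * twist x e = 1)
        then signOf (g z) * twist z x else 0) := by
    rw [← htot, mul_sum]
    exact sum_congr rfl fun z _ => hcoset z
  exact mul_left_cancel₀ hE.ne' key

/-- … hence the **dual-value expectation** `S(f,g) = ∑_x ∑_{z matched with x} f(x) (-1)^{g(z)+z·x}` for EVERY
real `f`: with `f = (-1)^a` and `g` BENT with a full M-subspace this is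
`Φ(a,g) = E_{(x,z) matched} (-1)^{a(x)+g(z)+x·z}` over `2^{3n/2}` pairs, exactly samplable (z uniform; x uniform
with `x|_E` = the linear part of `g` on `z ⊕ E`) — the SIGN WITH MAGNITUDE for any partner `a`, any damage:
the readout for the band's bent-half stratum (T-family `Φ = 7/8`, quartic duals), complementary to
`partialSign_affine` (which needs exactness but only ONE coset of co-dimension `O(log n)`). -/
theorem fsum_eq_sum_matched (f : (Fin n → Bool) → ℝ) (g : (Fin n → Bool) → Bool) {E : Finset (Fin n → Bool)}
    (h0 : zeroVec ∈ E) (hadd : ∀ e ∈ E, ∀ e' ∈ E, bxor e e' ∈ E) (hM : IsMSubspace g E) :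
    fsum f (fun y => signOf (g y)) =
      ∑ x, ∑ z, if (∀ e ∈ E, signOf (g (bxor z e)) * signOf (g z) * twist x e = 1)
        then f x * (signOf (g z) * twist z x) else 0 := by
  rw [fsum_eq_sum_mul_W]
  refine sum_congr rfl fun x _ => ?_
  rw [W_eq_sum_matched g h0 hadd hM x, mul_sum]
  refine sum_congr rfl fun z _ => ?_
  split_ifs <;> ring

/-! ### The open statements of the line -/

/-- **FLAT SEARCH ∈ FBPP** (the card's transfer `C⁺ = SEED ∧ G`, stated by its output). There are a
polynomial-time string function `flat` (run on `⟨instance, coins⟩`), a slack `c` and a coin polynomial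
`p` such that on EVERY exact cubic two-circuit instance (`B₂`-circuits, `n` even, both functions of
𝔽₂-degree `≤ 3`, `Φ² = 1`) at least half of the coin strings make `flat` output a GOOD FLAT of slack `c`:
an affine flat `v ⊕ F` of `g = C₁` with `|F|·(n+1)^c ≥ 2^{n/2}`. (A flat of `f = C₀` is as good: the
instance may be swapped internally; the output is verifiable, so success `1/2` is amplified downstream.) -/
def FlatSearch : Prop :=
  ∃ flat : List Bool → List Bool, flat ∈ FP ∧ ∃ c : ℕ, ∃ p : Polynomial ℕ,
    ∀ (I : KForrelationInstance) (hk : I.k = 2), I.IsOverB2 → Even I.n →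
      (∀ i, IsDegLeFun 3 (I.C i).eval) → I.value ^ 2 = 1 →
      (1 / 2 : ℝ) ≤ uniformProb (p.eval I.encode.length) {y | GoodFlat I hk c (flat (boolPair I.encode y))}

/-- The signed cubic 2-fold Forrelation problem OFF the exact slice ("the band"): YES `3/5 ≤ Φ < 1`,
NO `-1 < Φ ≤ -3/5` (`B₂`-circuits, `k = 2`, `n` even, degree `≤ 3`). -/
def signedBandProblem : PromiseProblem :=
  ⟨KForrelationInstance.encode ''
      {I | (I.IsOverB2 ∧ (3 / 5 : ℝ) ≤ I.value ∧ I.value < 1) ∧ I.k = 2 ∧ Even I.n ∧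
        ∀ i, IsDegLeFun 3 (I.C i).eval},
    KForrelationInstance.encode ''
      {I | (I.IsOverB2 ∧ I.value ≤ -(3 / 5 : ℝ) ∧ -1 < I.value) ∧ I.k = 2 ∧ Even I.n ∧
        ∀ i, IsDegLeFun 3 (I.C i).eval}⟩

/-- **Exact-slice readout**: FLAT SEARCH puts the signed EXACT slice (`signedExactCubicForrelationProblem 2`:
YES `Φ = 1`, NO `Φ = -1`) in `PromiseBPP'` — `partialSign_affine` + sampling + `FP` plumbing. -/
def ExactReadout : Prop :=
  FlatSearch → signedExactCubicForrelationProblem 2 ∈ PromiseBPP'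

/-- **The band is classical**: the signed problem off the exact slice is in `PromiseBPP'` (foreign
residual: structure conjecture + flag estimator of the block programme). -/
def BandInPrBPP : Prop :=
  signedBandProblem ∈ PromiseBPP'

/-- **Union lift**: isolation of exactness (route item r2 `NearExactIsExact`), a decider for the exact slice
and a decider for the band give a decider for the whole signed problem `signedCubicForrelationProblem 2`
(= the crux by `rfl`): magnitude selector at gap `1 - θ²` + AND/OR closure of `PromiseBPP'`. -/
def UnionLift : Prop :=
  NearExactIsExact → signedExactCubicForrelationProblem 2 ∈ PromiseBPP' →
    signedBandProblem ∈ PromiseBPP' → signedCubicForrelationProblem 2 ∈ PromiseBPP'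

/-! ### The stubs (registered obligations; `sorry` lives only here) -/

/-- STUB 1 — FLAT SEARCH ∈ FBPP (XL, OPEN, HARDEST own stub: SEED + generic completion `G` + re-seeding on
direct sums; closure soundness is `pingPong`). Refuted by a family of exact cubic pairs with no
poly-time-findable (or no existing) affine flat of `b` of co-dimension `O(log n)` — i.e. by r3. -/
theorem stub_flatSearch : FlatSearch := by
  sorry

/-- STUB 2 — EXACT READOUT (L, true on paper: `partialSign_affine` + Chebyshev at relative bias
`(n+1)^{-c}` + finder amplification + `mem_PromiseBPP'_of_fp_decider`; risk formal only). -/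
theorem stub_exactReadout : ExactReadout := by
  sorry

/-- STUB 3 — ISOLATION OF EXACTNESS = route item r2 `NearExactIsExact` (stmt-QuantumAdvantage-14043),
verbatim; shared with the route, not re-filed. Conjectured sharp constant `7/8` (T-family, n = 10). -/
theorem stub_isolation : NearExactIsExact := by
  sorry

/-- STUB 4 — THE BAND (XL, OPEN; foreign residual owned by the block programme: every band instance is
anchored blocks + RM(2) couplings + bounded damage, decided by the flag estimator; this line supplies the
exact-core anchors). Refuted by an in-promise non-exact family with no defect-`O(log n)` flag / block
structure (first place to look: glued cubic truncations around the PolujanPott2020 non-MM# bent cubics). -/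
theorem stub_band : BandInPrBPP := by
  sorry

/-- STUB 5 — UNION LIFT (L, true on paper: isolation ⇒ non-exact in-promise instances have `|Φ| ≤ θ₀ < 1`
(`IsDegLeFun.not`, `forrelation_not_right`, `KForrelationInstance.abs_value_le_one`); magnitude selector
`Φ² = 1` vs `Φ² ≤ θ₀²` from the `Φ²` estimator (`CubicDequant`) at gap `1 - θ₀²`; AND/OR closure of
`PromiseBPP'` via `exists_amplifier_of_mem_PromiseBPP'`; `mem_PromiseBPP'_of_subset`, `swap_mem_PromiseBPP'`). -/
theorem stub_unionLift : UnionLift := by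
  sorry

/-! ### Name-keyed aliases of the stub statements (the skeleton audit admits a hypothesis of the
composition only if its head constant is a registered obligation or is named like a declared stub) -/
namespace Registered

/-- Alias of `FlatSearch`. -/
abbrev stub_flatSearch : Prop := FlatSearch
/-- Alias of `ExactReadout`. -/
abbrev stub_exactReadout : Prop := ExactReadout
/-- Alias of `NearExactIsExact`. -/
abbrev stub_isolation : Prop := NearExactIsExact
/-- Alias of `BandInPrBPP`. -/
abbrev stub_band : Prop := BandInPrBPP
/-- Alias of `UnionLift`. -/
abbrev stub_unionLift : Prop := UnionLift

end Registered

/-! ### The composition: the stubs imply the crux, BY NAME (kernel-checked, no `sorry`) -/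

/-- **`SignedCubicForrelationInPrBPP` from the five stubs.** The exact-slice spine
`FlatSearch ⟹ signed exact slice ∈ PromiseBPP'` (readout = `partialSign_affine`, closure soundness =
`pingPong`, both proved above) is lifted to the whole promise by isolation (r2) and the band decider
through the union lift; the last step is `rfl` (`Disproof.crux_eq`). -/
theorem SignedCubicForrelationInPrBPP_of (h₁ : Registered.stub_flatSearch)
    (h₂ : Registered.stub_exactReadout) (h₃ : Registered.stub_isolation) (h₄ : Registered.stub_band)
    (h₅ : Registered.stub_unionLift) : SignedCubicForrelationInPrBPP :=
  h₅ h₃ (h₂ h₁) h₄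

/-- Wiring check: the declared stubs feed the composition as stated. -/
example : SignedCubicForrelationInPrBPP :=
  SignedCubicForrelationInPrBPP_of stub_flatSearch stub_exactReadout stub_isolation stub_band
    stub_unionLift

/-- **Intermediate payoff** (no isolation, no band): STUBS 1–2 alone refute the route's crux r3
`SignedExactCubicForrelationNotPrBPP` (stmt-QuantumAdvantage-13932; `Disproof.crux_imp_not_signedExact` is
the converse direction from the crux). -/
theorem not_signedExactNotPrBPP_of (h₁ : FlatSearch) (h₂ : ExactReadout) :
    ¬ SignedExactCubicForrelationNotPrBPP :=
  fun hr3 => hr3 (h₂ h₁)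

/-! ### Sanity -/

/-- The crux is literally `signedCubicForrelationProblem 2 ∈ PromiseBPP'` (what `UnionLift` concludes). -/
example : SignedCubicForrelationInPrBPP = (signedCubicForrelationProblem 2 ∈ PromiseBPP') := rfl

/-- The exact slice and the band are sub-promises of the crux's problem (so STUBS 2 and 4 are NECESSARY
for the crux by antitonicity, `mem_PromiseBPP'_of_subset` — neither is a costume). -/
example : (signedExactCubicForrelationProblem 2).yes ≤ (signedCubicForrelationProblem 2).yes ∧
    signedBandProblem.yes ≤ (signedCubicForrelationProblem 2).yes ∧
    signedBandProblem.no ≤ (signedCubicForrelationProblem 2).no := by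
  refine ⟨signedExactCubicForrelationProblem_yes_subset 2, ?_, ?_⟩
  · exact Set.image_mono fun I hI => ⟨⟨hI.1.1, hI.1.2.1⟩, hI.2⟩
  · exact Set.image_mono fun I hI => ⟨⟨hI.1.1, hI.1.2.1⟩, hI.2⟩

/-- … hence the crux implies the band stub and (with `Disproof.crux_imp_not_signedExact`) the exact one. -/
theorem band_of_crux (h : SignedCubicForrelationInPrBPP) : BandInPrBPP := by
  have h' : signedCubicForrelationProblem 2 ∈ PromiseBPP' := h
  obtain ⟨L', hL', p, hyes, hno⟩ := h'
  have hy : signedBandProblem.yes ≤ (signedCubicForrelationProblem 2).yes :=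
    Set.image_mono fun I hI => ⟨⟨hI.1.1, hI.1.2.1⟩, hI.2⟩
  have hn : signedBandProblem.no ≤ (signedCubicForrelationProblem 2).no :=
    Set.image_mono fun I hI => ⟨⟨hI.1.1, hI.1.2.1⟩, hI.2⟩
  exact ⟨L', hL', p, fun x hx => hyes x (hy hx), fun x hx => hno x (hn hx)⟩

end Summit.QuantumAdvantage.QuantumAdvantage.Cruxes.SignedCubicForrelationInPrBPP.SeedToSign

end
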